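import Mathlib
import Literature.Analysis.Complex.CauchyPompeiu
import Literature.Analysis.Complex.CauchyTransform
import Literature.Analysis.Complex.CauchyTransformBounds
import Literature.Analysis.Complex.CauchyTransformSupport
import Literature.Analysis.Complex.DbarAlongCalculus
import HarnessLib

/-!
# The operator-valued integrating factor of the similarity principle

For the vector-valued Carleman–Bers–Vekua similarity principle (a solution `w : ℂ → F` of
`∂̄w = A w` with a bounded operator field `A` is `Φ · h` with `Φ` continuous invertible and `h`
holomorphic; Wendl, *Lectures on holomorphic curves*, Thm 2.50; McDuff–Salamon, *J-holomorphic
curves and symplectic topology* (2012), §2.3) one needs an operator-valued solution `Ψ` of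
`∂̄Ψ = -Ψ B` for a given compactly supported operator field `B : ℂ → (F →L[ℂ] F)`. This file
constructs it by PICARD ITERATION for the integral equation `Ψ = 1 - T(Ψ B)` (`T` the Cauchy
transform, `∂̄ T = id` on `C¹` compactly supported densities), in sup norm only:

* `SimilarityVector.picard B n` — the iterates `Φ₀ = 1`, `Φₙ₊₁ = 1 - T(Φₙ B)`; each is `C¹`
  with `∂̄Φₙ₊₁ = -Φₙ B` (`dbarAlong_picard_succ`);
* under the smallness condition `16 ρ M ≤ 1` (`B` supported in `‖z‖ < ρ`, `‖B‖ ≤ M`) the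
  iterates converge locally uniformly (geometrically, ratio `θ = 4ρM ≤ 1/4`) to a continuous
  `SimilarityVector.integratingFactor B` =: `Ψ` with `Ψ = 1 - T(Ψ B)` (`integratingFactor_eq`),
  `‖Ψ z - 1‖ ≤ 1/3` on `‖z‖ ≤ ρ`, whence `‖x‖ ≤ (3/2) ‖Ψ z x‖` there
  (`norm_le_mul_norm_integratingFactor_apply`);
* the REPRESENTATION IDENTITY `integratingFactor_apply_eq_cauchyTransform`: for every `C¹`
  compactly supported `w : ℂ → F`,
  `Ψ z (w z) = T(ζ ↦ Ψ ζ (∂̄w ζ) - Ψ ζ (B ζ (w ζ)))(z)` — obtained from the Cauchy–Pompeiu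
  formula for the `C¹` functions `Φₙ₊₁ w` (`∂̄(Φₙ₊₁ w) = -Φₙ B w + Φₙ₊₁ ∂̄w`) by passing to the
  limit. This identity replaces the product rule `∂̄(Ψ w) = (∂̄Ψ) w + Ψ ∂̄w`, so that NO
  differentiability of the merely continuous `Ψ` is ever needed.

Everything is proved; the only definitions are the iterates and their limit. Consumed by
`Literature/Analysis/Complex/SimilarityPrincipleVector.lean`.

## References

* C. Wendl, *Lectures on Holomorphic Curves in Symplectic and Contact Geometry*
  (arXiv:1011.1690), §2.8, Thm 2.50 (similarity principle). [WendlLectures2010]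
* D. McDuff, D. Salamon, *J-holomorphic curves and symplectic topology*, 2nd ed. (2012), §2.3.
  [McDuffSalamon2012]
* L. Hörmander, *An introduction to complex analysis in several variables* (1973), Thm 1.2.2
  (`∂̄ T = id`). [HormanderSCV1973]
-/

noncomputable section

open scoped ContDiff Topology Real
open Set Metric MeasureTheory Filter Complex

namespace Literature.Analysis.Complex

namespace SimilarityVector

variable {F : Type*} [NormedAddCommGroup F] [NormedSpace ℂ F]

/-! ### Calculus of operator fields applied to vector fields -/

/-- `z ↦ Φ z (w z)` is `Cⁿ` (over `ℝ`) when the `ℂ`-linear operator field `Φ` and the vector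
field `w` are. [folklore] -/
theorem contDiff_clm_apply_real {Φ : ℂ → F →L[ℂ] F} {w : ℂ → F} {n : WithTop ℕ∞}
    (hΦ : ContDiff ℝ n Φ) (hw : ContDiff ℝ n w) : ContDiff ℝ n fun z => Φ z (w z) := by
  have hb : ContDiff ℝ n fun p : (F →L[ℂ] F) × F => p.1 p.2 :=
    ((isBoundedBilinearMap_apply (𝕜 := ℂ) (E := F) (F := F)).contDiff).restrict_scalars ℝ
  exact hb.comp (hΦ.prodMk hw)

/-- The real derivative of `z ↦ Φ z (w z)`. [folklore] -/
theorem hasFDerivAt_clm_apply_real {Φ : ℂ → F →L[ℂ] F} {w : ℂ → F} {z : ℂ}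
    {Φ' : ℂ →L[ℝ] F →L[ℂ] F} {w' : ℂ →L[ℝ] F} (hΦ : HasFDerivAt Φ Φ' z)
    (hw : HasFDerivAt w w' z) :
    HasFDerivAt (fun z => Φ z (w z))
      ((Φ z).restrictScalars ℝ ∘L w' + (ContinuousLinearMap.apply ℂ F (w z)).restrictScalars ℝ ∘L Φ')
      z := by
  have hb := ((isBoundedBilinearMap_apply (𝕜 := ℂ) (E := F) (F := F)).hasFDerivAt
    (Φ z, w z)).restrictScalars ℝ
  have hc := hb.comp z (hΦ.prodMk hw)
  refine hc.congr_fderiv ?_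
  ext v
  simp only [ContinuousLinearMap.coe_comp, Function.comp_apply,
    ContinuousLinearMap.coe_restrictScalars', ContinuousLinearMap.prod_apply,
    IsBoundedBilinearMap.deriv_apply, add_apply,
    ContinuousLinearMap.apply_apply]

/-- **Product rule for `∂̄` of an operator field applied to a vector field**:
`∂̄(Φ w) = (∂̄Φ) w + Φ (∂̄w)` (the operators `Φ z` being `ℂ`-linear). [folklore] -/
theorem dbarAlong_clm_apply {Φ : ℂ → F →L[ℂ] F} {w : ℂ → F} {z : ℂ}
    (hΦ : DifferentiableAt ℝ Φ z) (hw : DifferentiableAt ℝ w z) :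
    dbarAlong 1 (fun z => Φ z (w z)) z = (dbarAlong 1 Φ z) (w z) + Φ z (dbarAlong 1 w z) := by
  have h := (hasFDerivAt_clm_apply_real hΦ.hasFDerivAt hw.hasFDerivAt).fderiv
  simp only [dbarAlong, h, add_apply, ContinuousLinearMap.coe_comp,
    Function.comp_apply, ContinuousLinearMap.coe_restrictScalars',
    ContinuousLinearMap.apply_apply, smul_apply, map_add, map_smul,
    smul_add]
  abel

/-- `∂̄` of `z ↦ c - f z` is `-∂̄f`. [folklore] -/
theorem dbarAlong_const_sub {G : Type*} [NormedAddCommGroup G] [NormedSpace ℂ G] (c : G)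
    (f : ℂ → G) (z : ℂ) : dbarAlong 1 (fun z => c - f z) z = -dbarAlong 1 f z := by
  simp only [dbarAlong, fderiv_const_sub, neg_apply, smul_neg, ← neg_add, smul_neg]

/-! ### The Picard iterates -/

/-- The **Picard iterates** for `Ψ = 1 - T(Ψ B)`: `Φ₀ = 1`, `Φₙ₊₁ = 1 - T(Φₙ B)`.
[cite: WendlLectures2010, Thm 2.50 (proof)] -/
def picard (B : ℂ → F →L[ℂ] F) : ℕ → ℂ → (F →L[ℂ] F)
  | 0 => fun _ => 1
  | n + 1 => fun z => 1 - cauchyTransformAlong 1 (fun ζ => picard B n ζ * B ζ) z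

/-- `Φ₀ = 1`. [folklore] -/
@[simp] theorem picard_zero (B : ℂ → F →L[ℂ] F) (z : ℂ) : picard B 0 z = 1 := rfl

/-- `Φₙ₊₁ = 1 - T(Φₙ B)`. [folklore] -/
theorem picard_succ (B : ℂ → F →L[ℂ] F) (n : ℕ) (z : ℂ) :
    picard B (n + 1) z = 1 - cauchyTransformAlong 1 (fun ζ => picard B n ζ * B ζ) z := rfl

section Coefficient

variable {B : ℂ → F →L[ℂ] F} {ρ M : ℝ}

/-- A compactly supported operator field: support in the open disc `‖z‖ < ρ`. [folklore] -/
theorem hasCompactSupport_of_forall_norm_lt (hsupp : ∀ z, B z ≠ 0 → ‖z‖ < ρ) :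
    HasCompactSupport B := by
  refine HasCompactSupport.intro (isCompact_closedBall (0 : ℂ) ρ) fun z hz => ?_
  by_contra h
  exact hz (mem_closedBall_zero_iff.2 (hsupp z h).le)

/-- The products `Φₙ B` are supported in `‖z‖ < ρ`. [folklore] -/
theorem picard_mul_ne_zero (hsupp : ∀ z, B z ≠ 0 → ‖z‖ < ρ) (n : ℕ) (z : ℂ)
    (hz : picard B n z * B z ≠ 0) : ‖z‖ < ρ := by
  refine hsupp z fun h => hz ?_
  rw [h, mul_zero]

/-- The products `Φₙ B` have compact support. [folklore] -/
theorem hasCompactSupport_picard_mul (hsupp : ∀ z, B z ≠ 0 → ‖z‖ < ρ) (n : ℕ) :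
    HasCompactSupport fun ζ => picard B n ζ * B ζ :=
  hasCompactSupport_of_forall_norm_lt (picard_mul_ne_zero hsupp n)

/-- **The iterates are `C¹`** (`T` preserves `C¹` compactly supported densities). [folklore] -/
theorem contDiff_picard (hB : ContDiff ℝ 1 B) (hsupp : ∀ z, B z ≠ 0 → ‖z‖ < ρ) :
    ∀ n, ContDiff ℝ 1 (picard B n)
  | 0 => contDiff_const
  | n + 1 => by
    have h : ContDiff ℝ 1 fun ζ => picard B n ζ * B ζ := (contDiff_picard hB hsupp n).mul hB
    have hT := contDiff_cauchyTransformAlong h (hasCompactSupport_picard_mul hsupp n)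
      (one_ne_zero (α := ℂ))
    exact contDiff_const.sub hT

/-- The products `Φₙ B` are `C¹`. [folklore] -/
theorem contDiff_picard_mul (hB : ContDiff ℝ 1 B) (hsupp : ∀ z, B z ≠ 0 → ‖z‖ < ρ) (n : ℕ) :
    ContDiff ℝ 1 fun ζ => picard B n ζ * B ζ :=
  (contDiff_picard hB hsupp n).mul hB

/-- The iterates are continuous. [folklore] -/
theorem continuous_picard (hB : ContDiff ℝ 1 B) (hsupp : ∀ z, B z ≠ 0 → ‖z‖ < ρ) (n : ℕ) :
    Continuous (picard B n) :=
  (contDiff_picard hB hsupp n).continuous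

/-- The products `Φₙ B` are continuous. [folklore] -/
theorem continuous_picard_mul (hB : ContDiff ℝ 1 B) (hsupp : ∀ z, B z ≠ 0 → ‖z‖ < ρ) (n : ℕ) :
    Continuous fun ζ => picard B n ζ * B ζ :=
  (contDiff_picard_mul hB hsupp n).continuous

/-! ### Geometric convergence -/

/-- **Geometric decay of the increments on the disc**: with `θ = 4ρM`,
`‖Φₙ₊₁ z - Φₙ z‖ ≤ θ · θⁿ` for `‖z‖ ≤ ρ`. [folklore] -/
theorem dist_picard_succ_le (hB : ContDiff ℝ 1 B) (hρ : 0 < ρ) (hM : 0 ≤ M)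
    (hsupp : ∀ z, B z ≠ 0 → ‖z‖ < ρ) (hbound : ∀ z, ‖B z‖ ≤ M) :
    ∀ (n : ℕ) (z : ℂ), ‖z‖ ≤ ρ →
      dist (picard B n z) (picard B (n + 1) z) ≤ (4 * ρ * M) * (4 * ρ * M) ^ n := by
  intro n
  induction n with
  | zero =>
    intro z hz
    rw [pow_zero, mul_one, picard_zero, picard_succ, dist_eq_norm, sub_sub_cancel]
    have h := norm_cauchyTransform_le_of_norm_le (g := fun ζ => picard B 0 ζ * B ζ) hρ.le hM
      (picard_mul_ne_zero hsupp 0) (fun ζ => ?_) hz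
    · calc ‖cauchyTransformAlong 1 (fun ζ => picard B 0 ζ * B ζ) z‖ ≤ 2 * (ρ + ρ) * M := h
        _ = 4 * ρ * M := by ring
    · rw [picard_zero, one_mul]; exact hbound ζ
  | succ n ih =>
    intro z hz
    rw [picard_succ, picard_succ B (n + 1), dist_eq_norm, sub_sub_sub_cancel_left]
    have hG : 0 ≤ (4 * ρ * M) * (4 * ρ * M) ^ n * M := by positivity
    have key := norm_cauchyTransform_sub_le (continuous_picard_mul hB hsupp (n + 1))
      (hasCompactSupport_picard_mul hsupp (n + 1)) (continuous_picard_mul hB hsupp n)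
      (hasCompactSupport_picard_mul hsupp n) hρ.le hG (picard_mul_ne_zero hsupp (n + 1))
      (picard_mul_ne_zero hsupp n) (fun ζ hζ => ?_) hz
    · calc ‖cauchyTransformAlong 1 (fun ζ => picard B (n + 1) ζ * B ζ) z -
            cauchyTransformAlong 1 (fun ζ => picard B n ζ * B ζ) z‖
          ≤ 2 * (ρ + ρ) * ((4 * ρ * M) * (4 * ρ * M) ^ n * M) := key
        _ = (4 * ρ * M) * (4 * ρ * M) ^ (n + 1) := by ring
    · rw [← sub_mul]
      calc ‖(picard B (n + 1) ζ - picard B n ζ) * B ζ‖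
          ≤ ‖picard B (n + 1) ζ - picard B n ζ‖ * ‖B ζ‖ := norm_mul_le _ _
        _ ≤ ((4 * ρ * M) * (4 * ρ * M) ^ n) * M := by
          gcongr
          · rw [← dist_eq_norm, dist_comm]; exact ih ζ hζ.le
          · exact hbound ζ

/-- **Geometric decay of the increments everywhere**:
`‖Φₙ₊₁ z - Φₙ z‖ ≤ 2 (‖z‖ + ρ) M θⁿ`. [folklore] -/
theorem dist_picard_succ_le_global (hB : ContDiff ℝ 1 B) (hρ : 0 < ρ) (hM : 0 ≤ M)
    (hsupp : ∀ z, B z ≠ 0 → ‖z‖ < ρ) (hbound : ∀ z, ‖B z‖ ≤ M) (n : ℕ) (z : ℂ) :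
    dist (picard B n z) (picard B (n + 1) z) ≤ (2 * (‖z‖ + ρ) * M) * (4 * ρ * M) ^ n := by
  cases n with
  | zero =>
    rw [pow_zero, mul_one, picard_zero, picard_succ, dist_eq_norm, sub_sub_cancel]
    refine norm_cauchyTransform_le_global hρ.le hM (picard_mul_ne_zero hsupp 0) (fun ζ => ?_) z
    rw [picard_zero, one_mul]; exact hbound ζ
  | succ n =>
    rw [picard_succ, picard_succ B (n + 1), dist_eq_norm, sub_sub_sub_cancel_left]
    have hG : 0 ≤ (4 * ρ * M) * (4 * ρ * M) ^ n * M := by positivity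
    have key := norm_cauchyTransform_sub_le_global (continuous_picard_mul hB hsupp (n + 1))
      (hasCompactSupport_picard_mul hsupp (n + 1)) (continuous_picard_mul hB hsupp n)
      (hasCompactSupport_picard_mul hsupp n) hρ.le hG (picard_mul_ne_zero hsupp (n + 1))
      (picard_mul_ne_zero hsupp n) (fun ζ hζ => ?_) z
    · calc ‖cauchyTransformAlong 1 (fun ζ => picard B (n + 1) ζ * B ζ) z -
            cauchyTransformAlong 1 (fun ζ => picard B n ζ * B ζ) z‖
          ≤ 2 * (‖z‖ + ρ) * ((4 * ρ * M) * (4 * ρ * M) ^ n * M) := key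
        _ = (2 * (‖z‖ + ρ) * M) * (4 * ρ * M) ^ (n + 1) := by ring
    · rw [← sub_mul]
      calc ‖(picard B (n + 1) ζ - picard B n ζ) * B ζ‖
          ≤ ‖picard B (n + 1) ζ - picard B n ζ‖ * ‖B ζ‖ := norm_mul_le _ _
        _ ≤ ((4 * ρ * M) * (4 * ρ * M) ^ n) * M := by
          gcongr
          · rw [← dist_eq_norm, dist_comm]
            exact dist_picard_succ_le hB hρ hM hsupp hbound n ζ hζ.le
          · exact hbound ζ

/-! ### The limit `Ψ` -/

/-- Pointwise Cauchy property of the iterates (ratio `θ = 4ρM ≤ 1/4 < 1`). [folklore] -/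
theorem cauchySeq_picard (hB : ContDiff ℝ 1 B) (hρ : 0 < ρ) (hM : 0 ≤ M)
    (hsupp : ∀ z, B z ≠ 0 → ‖z‖ < ρ) (hbound : ∀ z, ‖B z‖ ≤ M) (hsmall : 16 * ρ * M ≤ 1)
    (z : ℂ) : CauchySeq fun n => picard B n z :=
  cauchySeq_of_le_geometric (4 * ρ * M) (2 * (‖z‖ + ρ) * M) (by nlinarith)
    (dist_picard_succ_le_global hB hρ hM hsupp hbound · z)

variable [CompleteSpace F]

/-- **`∂̄Φₙ₊₁ = -Φₙ B`** (`∂̄ T = id` on `C¹` compactly supported densities).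
[cite: HormanderSCV1973, Thm. 1.2.2] -/
theorem dbarAlong_picard_succ (hB : ContDiff ℝ 1 B) (hsupp : ∀ z, B z ≠ 0 → ‖z‖ < ρ) (n : ℕ)
    (z : ℂ) : dbarAlong 1 (picard B (n + 1)) z = -(picard B n z * B z) := by
  have h : picard B (n + 1) = fun z =>
      (1 : F →L[ℂ] F) - cauchyTransformAlong 1 (fun ζ => picard B n ζ * B ζ) z := rfl
  rw [h, dbarAlong_const_sub, dbarAlong_cauchyTransformAlong (contDiff_picard_mul hB hsupp n)
    (hasCompactSupport_picard_mul hsupp n) one_ne_zero]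

end Coefficient

/-- The **integrating factor** `Ψ = lim Φₙ` (pointwise limit of the Picard iterates; junk where
they do not converge). [cite: WendlLectures2010, Thm 2.50 (proof)] -/
def integratingFactor (B : ℂ → F →L[ℂ] F) (z : ℂ) : F →L[ℂ] F :=
  limUnder atTop fun n => picard B n z

section Limit

variable [CompleteSpace F] {B : ℂ → F →L[ℂ] F} {ρ M : ℝ}

/-- The iterates converge to `Ψ` pointwise. [folklore] -/
theorem tendsto_picard (hB : ContDiff ℝ 1 B) (hρ : 0 < ρ) (hM : 0 ≤ M)
    (hsupp : ∀ z, B z ≠ 0 → ‖z‖ < ρ) (hbound : ∀ z, ‖B z‖ ≤ M) (hsmall : 16 * ρ * M ≤ 1)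
    (z : ℂ) : Tendsto (fun n => picard B n z) atTop (𝓝 (integratingFactor B z)) :=
  (cauchySeq_picard hB hρ hM hsupp hbound hsmall z).tendsto_limUnder

/-- **Rate of convergence everywhere**: `‖Φₙ z - Ψ z‖ ≤ (8/3) (‖z‖ + ρ) M θⁿ`. [folklore] -/
theorem norm_picard_sub_integratingFactor_le (hB : ContDiff ℝ 1 B) (hρ : 0 < ρ) (hM : 0 ≤ M)
    (hsupp : ∀ z, B z ≠ 0 → ‖z‖ < ρ) (hbound : ∀ z, ‖B z‖ ≤ M) (hsmall : 16 * ρ * M ≤ 1)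
    (n : ℕ) (z : ℂ) :
    ‖picard B n z - integratingFactor B z‖ ≤ (8 / 3 * (‖z‖ + ρ) * M) * (4 * ρ * M) ^ n := by
  have hθ : 4 * ρ * M < 1 := by nlinarith
  have h := dist_le_of_le_geometric_of_tendsto (4 * ρ * M) (2 * (‖z‖ + ρ) * M) hθ
    (dist_picard_succ_le_global hB hρ hM hsupp hbound · z)
    (tendsto_picard hB hρ hM hsupp hbound hsmall z) n
  rw [dist_eq_norm] at h
  refine h.trans ?_
  rw [div_le_iff₀ (by linarith)]
  have h1 : 0 ≤ (‖z‖ + ρ) * M * (4 * ρ * M) ^ n := by positivity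
  nlinarith

/-- **Rate of convergence on the disc**: `‖1 - Ψ z‖ ≤ 1/3` for `‖z‖ ≤ ρ`. [folklore] -/
theorem norm_one_sub_integratingFactor_le (hB : ContDiff ℝ 1 B) (hρ : 0 < ρ) (hM : 0 ≤ M)
    (hsupp : ∀ z, B z ≠ 0 → ‖z‖ < ρ) (hbound : ∀ z, ‖B z‖ ≤ M) (hsmall : 16 * ρ * M ≤ 1)
    {z : ℂ} (hz : ‖z‖ ≤ ρ) : ‖1 - integratingFactor B z‖ ≤ 1 / 3 := by
  have hθ : 4 * ρ * M < 1 := by nlinarith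
  have h := dist_le_of_le_geometric_of_tendsto₀ (4 * ρ * M) (4 * ρ * M) hθ
    (fun n => dist_picard_succ_le hB hρ hM hsupp hbound n z hz)
    (tendsto_picard hB hρ hM hsupp hbound hsmall z)
  rw [picard_zero, dist_eq_norm] at h
  refine h.trans ?_
  rw [div_le_iff₀ (by linarith)]
  nlinarith

/-- **Lower bound through `Ψ` on the disc**: `‖x‖ ≤ (3/2) ‖Ψ z x‖` for `‖z‖ ≤ ρ`
(`Ψ z = 1 - (1 - Ψ z)` with `‖1 - Ψ z‖ ≤ 1/3`). [folklore] -/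
theorem norm_le_mul_norm_integratingFactor_apply (hB : ContDiff ℝ 1 B) (hρ : 0 < ρ)
    (hM : 0 ≤ M) (hsupp : ∀ z, B z ≠ 0 → ‖z‖ < ρ) (hbound : ∀ z, ‖B z‖ ≤ M)
    (hsmall : 16 * ρ * M ≤ 1) {z : ℂ} (hz : ‖z‖ ≤ ρ) (x : F) :
    ‖x‖ ≤ 3 / 2 * ‖integratingFactor B z x‖ := by
  have h1 := norm_one_sub_integratingFactor_le hB hρ hM hsupp hbound hsmall hz
  have h2 : ‖x - integratingFactor B z x‖ ≤ 1 / 3 * ‖x‖ := by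
    have : x - integratingFactor B z x = (1 - integratingFactor B z) x := by
      simp only [sub_apply, one_apply_eq_self]
    rw [this]
    exact ((1 - integratingFactor B z).le_opNorm x).trans
      (mul_le_mul_of_nonneg_right h1 (norm_nonneg x))
  have h3 : ‖x‖ ≤ ‖x - integratingFactor B z x‖ + ‖integratingFactor B z x‖ := by
    have := norm_add_le (x - integratingFactor B z x) (integratingFactor B z x)
    rwa [sub_add_cancel] at this
  linarith

/-- **Upper bound on the disc**: `‖Ψ z‖ ≤ 4/3` for `‖z‖ ≤ ρ`. [folklore] -/
theorem norm_integratingFactor_le (hB : ContDiff ℝ 1 B) (hρ : 0 < ρ) (hM : 0 ≤ M)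
    (hsupp : ∀ z, B z ≠ 0 → ‖z‖ < ρ) (hbound : ∀ z, ‖B z‖ ≤ M) (hsmall : 16 * ρ * M ≤ 1)
    {z : ℂ} (hz : ‖z‖ ≤ ρ) : ‖integratingFactor B z‖ ≤ 4 / 3 := by
  have h1 := norm_one_sub_integratingFactor_le hB hρ hM hsupp hbound hsmall hz
  have h2 : ‖integratingFactor B z‖ ≤ ‖(1 : F →L[ℂ] F)‖ + ‖1 - integratingFactor B z‖ := by
    have := norm_sub_le (1 : F →L[ℂ] F) (1 - integratingFactor B z)
    rwa [sub_sub_cancel] at this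
  have h3 : ‖(1 : F →L[ℂ] F)‖ ≤ 1 := ContinuousLinearMap.norm_id_le
  linarith

/-- **Uniform convergence on bounded sets.** [folklore] -/
theorem tendstoUniformlyOn_picard (hB : ContDiff ℝ 1 B) (hρ : 0 < ρ) (hM : 0 ≤ M)
    (hsupp : ∀ z, B z ≠ 0 → ‖z‖ < ρ) (hbound : ∀ z, ‖B z‖ ≤ M) (hsmall : 16 * ρ * M ≤ 1)
    (R : ℝ) :
    TendstoUniformlyOn (picard B) (integratingFactor B) atTop (closedBall (0 : ℂ) R) := by
  have hθ0 : 0 ≤ 4 * ρ * M := by positivity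
  have hθ : 4 * ρ * M < 1 := by nlinarith
  rw [Metric.tendstoUniformlyOn_iff]
  intro ε hε
  -- the constant on the ball
  set K : ℝ := 8 / 3 * (|R| + ρ) * M + 1 with hK
  have hK0 : 0 < K := by positivity
  have hpow : Tendsto (fun n : ℕ => (4 * ρ * M) ^ n) atTop (𝓝 0) :=
    tendsto_pow_atTop_nhds_zero_of_lt_one hθ0 hθ
  have hev : ∀ᶠ n : ℕ in atTop, (4 * ρ * M) ^ n < ε / K :=
    (tendsto_order.1 hpow).2 _ (div_pos hε hK0)
  filter_upwards [hev] with n hn z hz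
  rw [dist_comm, dist_eq_norm]
  have hzR : ‖z‖ ≤ |R| := (mem_closedBall_zero_iff.1 hz).trans (le_abs_self R)
  calc ‖picard B n z - integratingFactor B z‖
      ≤ (8 / 3 * (‖z‖ + ρ) * M) * (4 * ρ * M) ^ n :=
        norm_picard_sub_integratingFactor_le hB hρ hM hsupp hbound hsmall n z
    _ ≤ K * (4 * ρ * M) ^ n := by
        gcongr
        calc 8 / 3 * (‖z‖ + ρ) * M ≤ 8 / 3 * (|R| + ρ) * M := by gcongr
          _ ≤ K := by rw [hK]; linarith
    _ < K * (ε / K) := by gcongr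
    _ = ε := by field_simp

/-- **`Ψ` is continuous** (locally uniform limit of continuous functions). [folklore] -/
theorem continuous_integratingFactor (hB : ContDiff ℝ 1 B) (hρ : 0 < ρ) (hM : 0 ≤ M)
    (hsupp : ∀ z, B z ≠ 0 → ‖z‖ < ρ) (hbound : ∀ z, ‖B z‖ ≤ M) (hsmall : 16 * ρ * M ≤ 1) :
    Continuous (integratingFactor B) := by
  rw [continuous_iff_continuousAt]
  intro z
  have hcont : ContinuousOn (integratingFactor B) (closedBall (0 : ℂ) (‖z‖ + 1)) :=
    (tendstoUniformlyOn_picard hB hρ hM hsupp hbound hsmall (‖z‖ + 1)).continuousOn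
      (Eventually.of_forall fun n => (continuous_picard hB hsupp n).continuousOn).frequently
  refine hcont.continuousAt (mem_of_superset (ball_mem_nhds z one_pos) fun y hy => ?_)
  rw [mem_closedBall_zero_iff]
  rw [mem_ball, dist_eq_norm] at hy
  have := norm_le_norm_add_norm_sub' y z
  have h2 : ‖y - z‖ < 1 := hy
  linarith [norm_sub_rev y z]

/-- The product `Ψ B` is continuous with support in `‖z‖ < ρ`. [folklore] -/
theorem continuous_integratingFactor_mul (hB : ContDiff ℝ 1 B) (hρ : 0 < ρ) (hM : 0 ≤ M)
    (hsupp : ∀ z, B z ≠ 0 → ‖z‖ < ρ) (hbound : ∀ z, ‖B z‖ ≤ M) (hsmall : 16 * ρ * M ≤ 1) :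
    Continuous fun ζ => integratingFactor B ζ * B ζ :=
  (continuous_integratingFactor hB hρ hM hsupp hbound hsmall).mul hB.continuous

omit [CompleteSpace F] in
/-- The product `Ψ B` is supported in `‖z‖ < ρ`. [folklore] -/
theorem integratingFactor_mul_ne_zero (hsupp : ∀ z, B z ≠ 0 → ‖z‖ < ρ) (z : ℂ)
    (hz : integratingFactor B z * B z ≠ 0) : ‖z‖ < ρ := by
  refine hsupp z fun h => hz ?_
  rw [h, mul_zero]

/-- **The integral equation `Ψ = 1 - T(Ψ B)`.** [cite: WendlLectures2010, Thm 2.50 (proof)] -/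
theorem integratingFactor_eq (hB : ContDiff ℝ 1 B) (hρ : 0 < ρ) (hM : 0 ≤ M)
    (hsupp : ∀ z, B z ≠ 0 → ‖z‖ < ρ) (hbound : ∀ z, ‖B z‖ ≤ M) (hsmall : 16 * ρ * M ≤ 1)
    (z : ℂ) :
    integratingFactor B z =
      1 - cauchyTransformAlong 1 (fun ζ => integratingFactor B ζ * B ζ) z := by
  have hθ0 : 0 ≤ 4 * ρ * M := by positivity
  have hθ : 4 * ρ * M < 1 := by nlinarith
  -- `Φₙ₊₁ z → Ψ z`
  have h1 : Tendsto (fun n => picard B (n + 1) z) atTop (𝓝 (integratingFactor B z)) :=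
    (tendsto_picard hB hρ hM hsupp hbound hsmall z).comp (tendsto_add_atTop_nat 1)
  -- `T(Φₙ B) z → T(Ψ B) z`
  have h2 : Tendsto (fun n => cauchyTransformAlong 1 (fun ζ => picard B n ζ * B ζ) z) atTop
      (𝓝 (cauchyTransformAlong 1 (fun ζ => integratingFactor B ζ * B ζ) z)) := by
    rw [Metric.tendsto_atTop]
    intro ε hε
    set K : ℝ := 2 * (‖z‖ + ρ) * (8 / 3 * (ρ + ρ) * M * M) + 1 with hK
    have hK0 : 0 < K := by positivity
    have hpow : Tendsto (fun n : ℕ => (4 * ρ * M) ^ n) atTop (𝓝 0) :=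
      tendsto_pow_atTop_nhds_zero_of_lt_one hθ0 hθ
    obtain ⟨N, hN⟩ := (Metric.tendsto_atTop.1 hpow) (ε / K) (div_pos hε hK0)
    refine ⟨N, fun n hn => ?_⟩
    have hn' : (4 * ρ * M) ^ n < ε / K := by
      have := hN n hn
      rwa [dist_zero_right, Real.norm_of_nonneg (pow_nonneg hθ0 n)] at this
    rw [dist_eq_norm]
    have hG : 0 ≤ 8 / 3 * (ρ + ρ) * M * (4 * ρ * M) ^ n * M := by positivity
    have key := norm_cauchyTransform_sub_le_global (continuous_picard_mul hB hsupp n)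
      (hasCompactSupport_picard_mul hsupp n)
      (continuous_integratingFactor_mul hB hρ hM hsupp hbound hsmall)
      (hasCompactSupport_of_forall_norm_lt (integratingFactor_mul_ne_zero hsupp))
      hρ.le hG (picard_mul_ne_zero hsupp n) (integratingFactor_mul_ne_zero hsupp)
      (fun ζ hζ => ?_) z
    · calc ‖cauchyTransformAlong 1 (fun ζ => picard B n ζ * B ζ) z -
            cauchyTransformAlong 1 (fun ζ => integratingFactor B ζ * B ζ) z‖
          ≤ 2 * (‖z‖ + ρ) * (8 / 3 * (ρ + ρ) * M * (4 * ρ * M) ^ n * M) := key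
        _ ≤ K * (4 * ρ * M) ^ n := by
          have : 2 * (‖z‖ + ρ) * (8 / 3 * (ρ + ρ) * M * (4 * ρ * M) ^ n * M) =
              (2 * (‖z‖ + ρ) * (8 / 3 * (ρ + ρ) * M * M)) * (4 * ρ * M) ^ n := by ring
          rw [this]
          gcongr
          rw [hK]; linarith
        _ < K * (ε / K) := by gcongr
        _ = ε := by field_simp
    · rw [← sub_mul]
      calc ‖(picard B n ζ - integratingFactor B ζ) * B ζ‖
          ≤ ‖picard B n ζ - integratingFactor B ζ‖ * ‖B ζ‖ := norm_mul_le _ _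
        _ ≤ (8 / 3 * (‖ζ‖ + ρ) * M) * (4 * ρ * M) ^ n * M := by
          gcongr
          · exact norm_picard_sub_integratingFactor_le hB hρ hM hsupp hbound hsmall n ζ
          · exact hbound ζ
        _ ≤ 8 / 3 * (ρ + ρ) * M * (4 * ρ * M) ^ n * M := by gcongr
  have h3 : Tendsto (fun n => picard B (n + 1) z) atTop
      (𝓝 (1 - cauchyTransformAlong 1 (fun ζ => integratingFactor B ζ * B ζ) z)) := by
    simp only [picard_succ]
    exact tendsto_const_nhds.sub h2
  exact tendsto_nhds_unique h1 h3

/-! ### The representation identity `Ψ w = T(Ψ ∂̄w - Ψ B w)` -/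

/-- A continuous compactly supported function is bounded. [folklore] -/
theorem exists_bound_of_hasCompactSupport {G : Type*} [NormedAddCommGroup G] {f : ℂ → G}
    (hf : Continuous f) (hs : HasCompactSupport f) : ∃ C : ℝ, 0 ≤ C ∧ ∀ z, ‖f z‖ ≤ C := by
  obtain ⟨C, hC⟩ := hf.bounded_above_of_compact_support hs
  exact ⟨max C 0, le_max_right _ _, fun z => (hC z).trans (le_max_left _ _)⟩

/-- **Cauchy–Pompeiu for the iterates**: for `C¹` compactly supported `w : ℂ → F`,
`Φₙ₊₁ z (w z) = T(ζ ↦ Φₙ₊₁ ζ (∂̄w ζ) - Φₙ ζ (B ζ (w ζ)))(z)`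
(`∂̄(Φₙ₊₁ w) = (∂̄Φₙ₊₁) w + Φₙ₊₁ ∂̄w` and `∂̄Φₙ₊₁ = -Φₙ B`).
[cite: HormanderSCV1973, Thm. 1.2.1] -/
theorem picard_succ_apply_eq_cauchyTransform (hB : ContDiff ℝ 1 B)
    (hsupp : ∀ z, B z ≠ 0 → ‖z‖ < ρ) {w : ℂ → F} (hw : ContDiff ℝ 1 w)
    (hws : HasCompactSupport w) (n : ℕ) (z : ℂ) :
    picard B (n + 1) z (w z) = cauchyTransformAlong 1
      (fun ζ => picard B (n + 1) ζ (dbarAlong 1 w ζ) - picard B n ζ (B ζ (w ζ))) z := by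
  have hφ : ContDiff ℝ 1 fun ζ => picard B (n + 1) ζ (w ζ) :=
    contDiff_clm_apply_real (contDiff_picard hB hsupp (n + 1)) hw
  have hφs : HasCompactSupport fun ζ => picard B (n + 1) ζ (w ζ) := by
    refine hws.mono ?_
    intro ζ hζ
    rw [Function.mem_support] at hζ ⊢
    intro h
    exact hζ (by rw [h, map_zero])
  have hCP := cauchyTransformAlong_dbarAlong_self hφ hφs (one_ne_zero (α := ℂ)) z
  rw [← hCP]
  congr 1
  funext ζ
  rw [dbarAlong_clm_apply ((contDiff_picard hB hsupp (n + 1)).differentiable one_ne_zero ζ)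
    (hw.differentiable one_ne_zero ζ), dbarAlong_picard_succ hB hsupp n ζ]
  simp only [neg_apply, mul_apply_eq_comp]
  abel

/-- **The representation identity.** For `C¹` compactly supported `w : ℂ → F`,
`Ψ z (w z) = T(ζ ↦ Ψ ζ (∂̄w ζ) - Ψ ζ (B ζ (w ζ)))(z)`: the limit of
`picard_succ_apply_eq_cauchyTransform` (sup-norm continuity of `T` on densities supported in a
fixed disc). It plays the role of the product rule `∂̄(Ψ w) = -Ψ B w + Ψ ∂̄w` for the merely
continuous `Ψ`. [cite: WendlLectures2010, Thm 2.50 (proof)] -/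
theorem integratingFactor_apply_eq_cauchyTransform (hB : ContDiff ℝ 1 B) (hρ : 0 < ρ)
    (hM : 0 ≤ M) (hsupp : ∀ z, B z ≠ 0 → ‖z‖ < ρ) (hbound : ∀ z, ‖B z‖ ≤ M)
    (hsmall : 16 * ρ * M ≤ 1) {w : ℂ → F} (hw : ContDiff ℝ 1 w) (hws : HasCompactSupport w)
    (z : ℂ) :
    integratingFactor B z (w z) = cauchyTransformAlong 1
      (fun ζ => integratingFactor B ζ (dbarAlong 1 w ζ) - integratingFactor B ζ (B ζ (w ζ))) z := by
  have hθ0 : 0 ≤ 4 * ρ * M := by positivity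
  have hθ : 4 * ρ * M < 1 := by nlinarith
  have hΨc := continuous_integratingFactor hB hρ hM hsupp hbound hsmall
  -- a disc containing the support of `w` (and of `∂̄w`)
  obtain ⟨ρw, hρw0, hρw⟩ : ∃ ρw : ℝ, 0 < ρw ∧ tsupport w ⊆ ball (0 : ℂ) ρw := by
    obtain ⟨r, hr⟩ := hws.isCompact.isBounded.subset_ball (0 : ℂ)
    exact ⟨max r 1, by positivity, hr.trans (ball_subset_ball (le_max_left _ _))⟩
  have hw0 : ∀ ζ, ζ ∉ tsupport w → w ζ = 0 := fun ζ hζ => image_eq_zero_of_notMem_tsupport hζ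
  have hdw0 : ∀ ζ, ζ ∉ tsupport w → dbarAlong 1 w ζ = 0 := by
    intro ζ hζ
    have h : fderiv ℝ w ζ = 0 := by
      by_contra h
      exact hζ (support_fderiv_subset ℝ (Function.mem_support.2 h))
    simp only [dbarAlong, h, zero_apply, smul_zero, add_zero]
  -- bounds for `w` and `∂̄w`
  obtain ⟨W₀, hW₀, hwW₀⟩ := exists_bound_of_hasCompactSupport hw.continuous hws
  have hdwc : Continuous (dbarAlong 1 w) := continuous_dbarAlong hw 1
  have hdws : HasCompactSupport (dbarAlong 1 w) :=
    HasCompactSupport.intro hws.isCompact fun ζ hζ => hdw0 ζ hζ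
  obtain ⟨W₁, hW₁, hwW₁⟩ := exists_bound_of_hasCompactSupport hdwc hdws
  -- the densities
  set g : ℂ → F := fun ζ =>
    integratingFactor B ζ (dbarAlong 1 w ζ) - integratingFactor B ζ (B ζ (w ζ)) with hg
  set gn : ℕ → ℂ → F := fun n ζ =>
    picard B (n + 1) ζ (dbarAlong 1 w ζ) - picard B n ζ (B ζ (w ζ)) with hgn
  have hgc : Continuous g := by
    refine Continuous.sub ?_ ?_
    · exact (contDiff_clm_apply_real (n := 0) (contDiff_zero.2 hΨc)
        (contDiff_zero.2 hdwc)).continuous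
    · exact (contDiff_clm_apply_real (n := 0) (contDiff_zero.2 hΨc)
        (contDiff_zero.2 ((contDiff_clm_apply_real (n := 0) (contDiff_zero.2 hB.continuous)
          (contDiff_zero.2 hw.continuous)).continuous))).continuous
  have hgnc : ∀ n, Continuous (gn n) := by
    intro n
    refine Continuous.sub ?_ ?_
    · exact (contDiff_clm_apply_real (n := 0) (contDiff_zero.2 (continuous_picard hB hsupp _))
        (contDiff_zero.2 hdwc)).continuous
    · exact (contDiff_clm_apply_real (n := 0) (contDiff_zero.2 (continuous_picard hB hsupp _))
        (contDiff_zero.2 ((contDiff_clm_apply_real (n := 0) (contDiff_zero.2 hB.continuous)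
          (contDiff_zero.2 hw.continuous)).continuous))).continuous
  have hg0 : ∀ ζ, ζ ∉ tsupport w → g ζ = 0 := by
    intro ζ hζ; simp only [hg, hw0 ζ hζ, hdw0 ζ hζ, map_zero, sub_zero]
  have hgn0 : ∀ n ζ, ζ ∉ tsupport w → gn n ζ = 0 := by
    intro n ζ hζ; simp only [hgn, hw0 ζ hζ, hdw0 ζ hζ, map_zero, sub_zero]
  have hgs : HasCompactSupport g := HasCompactSupport.intro hws.isCompact hg0
  have hgns : ∀ n, HasCompactSupport (gn n) := fun n =>
    HasCompactSupport.intro hws.isCompact (hgn0 n)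
  have hgρ : ∀ ζ, g ζ ≠ 0 → ‖ζ‖ < ρw := by
    intro ζ hζ
    by_contra h
    exact hζ (hg0 ζ fun hmem => h (mem_ball_zero_iff.1 (hρw hmem)))
  have hgnρ : ∀ n ζ, gn n ζ ≠ 0 → ‖ζ‖ < ρw := by
    intro n ζ hζ
    by_contra h
    exact hζ (hgn0 n ζ fun hmem => h (mem_ball_zero_iff.1 (hρw hmem)))
  -- `Φₙ₊₁ z (w z) → Ψ z (w z)`
  have h1 : Tendsto (fun n => picard B (n + 1) z (w z)) atTop
      (𝓝 (integratingFactor B z (w z))) := by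
    have ht := (tendsto_picard hB hρ hM hsupp hbound hsmall z).comp (tendsto_add_atTop_nat 1)
    exact ((ContinuousLinearMap.apply ℂ F (w z)).continuous.tendsto _).comp ht
  -- `T gₙ z → T g z`
  have h2 : Tendsto (fun n => cauchyTransformAlong 1 (gn n) z) atTop
      (𝓝 (cauchyTransformAlong 1 g z)) := by
    rw [Metric.tendsto_atTop]
    intro ε hε
    set E₀ : ℝ := 8 / 3 * (ρw + ρ) * M with hE₀
    set K : ℝ := 2 * (‖z‖ + ρw) * (E₀ * W₁ + E₀ * (M * W₀)) + 1 with hK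
    have hE₀0 : 0 ≤ E₀ := by positivity
    have hK0 : 0 < K := by positivity
    have hpow : Tendsto (fun n : ℕ => (4 * ρ * M) ^ n) atTop (𝓝 0) :=
      tendsto_pow_atTop_nhds_zero_of_lt_one hθ0 hθ
    obtain ⟨N, hN⟩ := (Metric.tendsto_atTop.1 hpow) (ε / K) (div_pos hε hK0)
    refine ⟨N, fun n hn => ?_⟩
    have hn' : (4 * ρ * M) ^ n < ε / K := by
      have := hN n hn
      rwa [dist_zero_right, Real.norm_of_nonneg (pow_nonneg hθ0 n)] at this
    have hpow1 : (4 * ρ * M) ^ (n + 1) ≤ (4 * ρ * M) ^ n :=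
      pow_le_pow_of_le_one hθ0 hθ.le (Nat.le_succ n)
    rw [dist_eq_norm]
    -- sup bound of `gₙ - g` on the disc `‖ζ‖ < ρw`
    have hG : 0 ≤ (E₀ * W₁ + E₀ * (M * W₀)) * (4 * ρ * M) ^ n := by positivity
    have key := norm_cauchyTransform_sub_le_global (hgnc n) (hgns n) hgc hgs hρw0.le hG
      (hgnρ n) hgρ (fun ζ hζ => ?_) z
    · calc ‖cauchyTransformAlong 1 (gn n) z - cauchyTransformAlong 1 g z‖
          ≤ 2 * (‖z‖ + ρw) * ((E₀ * W₁ + E₀ * (M * W₀)) * (4 * ρ * M) ^ n) := key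
        _ ≤ K * (4 * ρ * M) ^ n := by
          have : 2 * (‖z‖ + ρw) * ((E₀ * W₁ + E₀ * (M * W₀)) * (4 * ρ * M) ^ n) =
              (2 * (‖z‖ + ρw) * (E₀ * W₁ + E₀ * (M * W₀))) * (4 * ρ * M) ^ n := by ring
          rw [this]
          gcongr
          rw [hK]; linarith
        _ < K * (ε / K) := by gcongr
        _ = ε := by field_simp
    · -- pointwise: `‖gₙ ζ - g ζ‖ ≤ …`
      have hζ' : ‖ζ‖ ≤ ρw := hζ.le
      have hrate : ∀ m, ‖picard B m ζ - integratingFactor B ζ‖ ≤ E₀ * (4 * ρ * M) ^ m := by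
        intro m
        calc ‖picard B m ζ - integratingFactor B ζ‖
            ≤ (8 / 3 * (‖ζ‖ + ρ) * M) * (4 * ρ * M) ^ m :=
              norm_picard_sub_integratingFactor_le hB hρ hM hsupp hbound hsmall m ζ
          _ ≤ E₀ * (4 * ρ * M) ^ m := by rw [hE₀]; gcongr
      have e : gn n ζ - g ζ =
          (picard B (n + 1) ζ - integratingFactor B ζ) (dbarAlong 1 w ζ) -
            (picard B n ζ - integratingFactor B ζ) (B ζ (w ζ)) := by
        simp only [hgn, hg, sub_apply]
        abel
      rw [e]
      calc ‖(picard B (n + 1) ζ - integratingFactor B ζ) (dbarAlong 1 w ζ) -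
              (picard B n ζ - integratingFactor B ζ) (B ζ (w ζ))‖
          ≤ ‖(picard B (n + 1) ζ - integratingFactor B ζ) (dbarAlong 1 w ζ)‖ +
              ‖(picard B n ζ - integratingFactor B ζ) (B ζ (w ζ))‖ := norm_sub_le _ _
        _ ≤ ‖picard B (n + 1) ζ - integratingFactor B ζ‖ * ‖dbarAlong 1 w ζ‖ +
              ‖picard B n ζ - integratingFactor B ζ‖ * (‖B ζ‖ * ‖w ζ‖) := by
          gcongr
          · exact ContinuousLinearMap.le_opNorm _ _
          · exact (ContinuousLinearMap.le_opNorm _ _).trans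
              (mul_le_mul_of_nonneg_left (ContinuousLinearMap.le_opNorm _ _) (norm_nonneg _))
        _ ≤ E₀ * (4 * ρ * M) ^ (n + 1) * W₁ + E₀ * (4 * ρ * M) ^ n * (M * W₀) := by
          gcongr
          · exact hrate (n + 1)
          · exact hwW₁ ζ
          · exact hrate n
          · exact hbound ζ
          · exact hwW₀ ζ
        _ ≤ E₀ * (4 * ρ * M) ^ n * W₁ + E₀ * (4 * ρ * M) ^ n * (M * W₀) := by gcongr
        _ = (E₀ * W₁ + E₀ * (M * W₀)) * (4 * ρ * M) ^ n := by ring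
  have h3 : Tendsto (fun n => picard B (n + 1) z (w z)) atTop
      (𝓝 (cauchyTransformAlong 1 g z)) := by
    have e : (fun n => picard B (n + 1) z (w z)) = fun n => cauchyTransformAlong 1 (gn n) z :=
      funext fun n => picard_succ_apply_eq_cauchyTransform hB hsupp hw hws n z
    rw [e]
    exact h2
  exact tendsto_nhds_unique h1 h3

end Limit

end SimilarityVector

end Literature.Analysis.Complex
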